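import Summits.ValiantsHypothesis.ValiantsHypothesis.Theorems.ZeroOneTransfer.Negative.TopComponentFree
import Summits.ValiantsHypothesis.ValiantsHypothesis.Theorems.ZeroOneTransfer.Negative.KillRows
import Literature.Barriers.ValiantsHypothesis.MonotoneGapUpper
import Literature.Computability.AlgebraicComplexity.ValiantClassesProofs

/-!
# `ZeroOneTransfer` — negative lemma: LOW-DEGREE COFACTORS DO NOT HELP

Crux `stmt-ValiantsHypothesis-5066` (`Theses.DivisionGap.ZeroOneTransfer`, route DivisionGap).
Standing disprover (cdisprove), `Cruxes/ZeroOneTransfer/Disproof.lean` §(B2).  Uses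
`TopComponentFree.lean` (initial forms are free) and `KillRows.lean` (row-killing projection,
Jerrum–Snir by support).

* `exists_rows_topComponent` — with the row-lexicographic weight `x_{i,j} ↦ (deg h + 1)^i`, the
  top component of `h ≠ 0` has all its variables in a set `R` of at most `deg h` rows (base-`B`
  uniqueness `eq_of_sum_mul_pow_eq`).
* `two_rpow_le_complexity_stPoly_mul` — **for every nonzero `h ∈ ℝ≥0[x]` with `deg h + 60 ≤ N`:
  `2^{(N - deg h)/20} ≤ L_{ℝ≥0}(ST_N · h) + 1`** — a cofactor of degree `δ` buys at most `δ` rows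
  of the spanning-tree polynomial: pass to the top row-lexicographic component (free; `ST` is
  row-homogeneous), kill the `≤ δ` rows carrying the cofactor (it becomes a nonzero constant),
  land on a polynomial with the support of `ST_{N-δ'}`, apply Jerrum–Snir.
* `zeroOneTransfer_lowDegreeCofactor_false` — the natural strengthening of the crux asking for a
  cofactor of degree `≤ deg(f_n)/2` is FALSE (witness `ST`: 0/1 coefficients, `VP_ℂ`).  So every
  positivity normal form `f·h = g` behind a proof of `ZeroOneTransfer` must use cofactors of
  degree comparable to `deg f` (for `ST_N`: `> N - 20((log₂ N + c)^c + 1)`), as the star–mesh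
  certificate of FominGrigorievKoshevoy2014 Thm 7.2 indeed does.
[folklore] [cite: JerrumSnir1982, §4.5 and §5.1]
-/

namespace Summit.ValiantsHypothesis.ValiantsHypothesis.Theorems.ZeroOneTransfer.Negative

open Literature.Computability.AlgebraicComplexity Literature.Barriers.ValiantsHypothesis
open MvPolynomial Finset
open scoped NNReal

noncomputable section

/-! ### Concentrating the cofactor on few rows: the lexicographic row weight -/

section Rows

variable {N : ℕ} {β : Type*}

/-- Base-`B` digit vectors are determined by their value. [folklore] -/
theorem eq_of_sum_mul_pow_eq {B : ℕ} :
    ∀ {n : ℕ} (f g : Fin n → ℕ), (∀ i, f i < B) → (∀ i, g i < B) →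
      ∑ i, f i * B ^ (i : ℕ) = ∑ i, g i * B ^ (i : ℕ) → f = g := by
  intro n
  induction n with
  | zero => intro f g _ _ _; funext i; exact i.elim0
  | succ n ih =>
    intro f g hf hg h
    rw [Fin.sum_univ_succ, Fin.sum_univ_succ] at h
    simp only [Fin.val_zero, pow_zero, mul_one, Fin.val_succ, pow_succ] at h
    have hB : 0 < B := lt_of_le_of_lt (Nat.zero_le _) (hf 0)
    have hre : ∀ u : Fin (n + 1) → ℕ, ∑ i : Fin n, u i.succ * (B ^ (i : ℕ) * B) =
        B * ∑ i : Fin n, u i.succ * B ^ (i : ℕ) := by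
      intro u; rw [Finset.mul_sum]; refine Finset.sum_congr rfl fun i _ => ?_; ring
    rw [hre f, hre g] at h
    have h0 : f 0 = g 0 := by
      have := congrArg (· % B) h
      simpa [Nat.add_mul_mod_self_left, Nat.mod_eq_of_lt (hf 0), Nat.mod_eq_of_lt (hg 0)] using this
    rw [h0] at h
    have h1 : ∑ i : Fin n, f i.succ * B ^ (i : ℕ) = ∑ i : Fin n, g i.succ * B ^ (i : ℕ) :=
      Nat.eq_of_mul_eq_mul_left hB (by omega)
    have h2 := ih (fun i => f i.succ) (fun i => g i.succ) (fun i => hf _) (fun i => hg _) h1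
    funext i
    refine Fin.cases h0 (fun i => ?_) i
    exact congrFun h2 i

/-- The lexicographic row weight in base `B`: variable `x_{i,j}` weighs `B^i`. [folklore] -/
def rowWeight (B : ℕ) : Fin N × β → ℕ := fun v => B ^ (v.1 : ℕ)

/-- The row degree of a monomial in row `i`. [folklore] -/
def rowDeg (d : (Fin N × β) →₀ ℕ) (i : Fin N) : ℕ :=
  ∑ v ∈ d.support with v.1 = i, d v

/-- The row weight of a monomial is its base-`B` number with digits the row degrees. [folklore] -/
theorem weight_rowWeight (B : ℕ) (d : (Fin N × β) →₀ ℕ) :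
    Finsupp.weight (rowWeight B) d = ∑ i : Fin N, rowDeg d i * B ^ (i : ℕ) := by
  classical
  rw [Finsupp.weight_apply, Finsupp.sum]
  simp only [rowWeight, smul_eq_mul, rowDeg, Finset.sum_mul]
  rw [← Finset.sum_fiberwise d.support Prod.fst (fun v => d v * B ^ (v.1 : ℕ))]
  refine Finset.sum_congr rfl fun i _ => Finset.sum_congr rfl fun v hv => ?_
  rw [(Finset.mem_filter.mp hv).2]

/-- Row degrees are bounded by the degree. [folklore] -/
theorem rowDeg_le_degree (d : (Fin N × β) →₀ ℕ) (i : Fin N) :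
    rowDeg d i ≤ d.sum fun _ k => k := by
  classical
  rw [Finsupp.sum]
  exact Finset.sum_le_sum_of_subset_of_nonneg (Finset.filter_subset _ _) fun _ _ _ => Nat.zero_le _

/-- A variable occurring in `d` makes its row degree positive. [folklore] -/
theorem rowDeg_pos_of_mem {d : (Fin N × β) →₀ ℕ} {v : Fin N × β}
    (hv : v ∈ d.support) : 0 < rowDeg d v.1 := by
  classical
  unfold rowDeg
  have hmem : v ∈ d.support.filter (fun u => u.1 = v.1) := Finset.mem_filter.mpr ⟨hv, rfl⟩
  exact lt_of_lt_of_le (Nat.pos_of_ne_zero (Finsupp.mem_support_iff.mp hv))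
    (Finset.single_le_sum (f := fun u => d u) (fun _ _ => Nat.zero_le _) hmem)

/-- The rows of positive row degree are at most `deg d` many. [folklore] -/
theorem card_filter_rowDeg_pos_le (d : (Fin N × β) →₀ ℕ) :
    (Finset.univ.filter fun i : Fin N => 0 < rowDeg d i).card ≤ d.sum fun _ k => k := by
  classical
  calc (Finset.univ.filter fun i : Fin N => 0 < rowDeg d i).card
      = ∑ i ∈ Finset.univ.filter (fun i : Fin N => 0 < rowDeg d i), 1 := by simp
    _ ≤ ∑ i ∈ Finset.univ.filter (fun i : Fin N => 0 < rowDeg d i), rowDeg d i :=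
        Finset.sum_le_sum fun i hi => (Finset.mem_filter.mp hi).2
    _ ≤ ∑ i : Fin N, rowDeg d i :=
        Finset.sum_le_sum_of_subset_of_nonneg (Finset.filter_subset _ _) fun _ _ _ => Nat.zero_le _
    _ = d.sum fun _ k => k := by
        rw [Finsupp.sum]
        simp only [rowDeg]
        rw [← Finset.sum_fiberwise d.support Prod.fst (fun v => d v)]

/-- **The top row-lexicographic component of a nonzero `h` lives on at most `deg h` rows**: with
`B = deg h + 1`, all monomials of `top_{rowWeight B} h` have the same row-degree vector, whose
support `R` has at most `deg h` rows, and every variable of every such monomial lies in a row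
of `R`. [folklore] -/
theorem exists_rows_topComponent {h : MvPolynomial (Fin N × β) ℝ≥0} (hh : h ≠ 0) :
    ∃ R : Finset (Fin N), R.card ≤ h.totalDegree ∧
      ∀ d ∈ (topComponent (rowWeight (h.totalDegree + 1)) h).support, ∀ v ∈ d.support, v.1 ∈ R := by
  classical
  set B := h.totalDegree + 1 with hB
  set hs := topComponent (rowWeight B) h with hhs
  have hne : hs ≠ 0 := topComponent_ne_zero _ hh
  obtain ⟨d₀, hd₀⟩ := exists_coeff_ne_zero hne
  have hd₀s : d₀ ∈ hs.support := mem_support_iff.mpr hd₀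
  refine ⟨Finset.univ.filter fun i => 0 < rowDeg d₀ i, ?_, ?_⟩
  · refine (card_filter_rowDeg_pos_le d₀).trans ?_
    exact le_totalDegree (support_topComponent_subset _ h hd₀s)
  · intro d hd v hv
    -- `d` and `d₀` have the same row weight, hence the same row degrees
    have hwd : Finsupp.weight (rowWeight B) d = weightedTotalDegree (rowWeight B) h := by
      have := mem_support_iff.mp hd
      rw [hhs, coeff_topComponent] at this
      by_contra hne'
      exact this (if_neg hne')
    have hwd₀ : Finsupp.weight (rowWeight B) d₀ = weightedTotalDegree (rowWeight B) h := by
      have := mem_support_iff.mp hd₀s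
      rw [hhs, coeff_topComponent] at this
      by_contra hne'
      exact this (if_neg hne')
    have hlt : ∀ d' ∈ hs.support, ∀ i, rowDeg d' i < B := by
      intro d' hd' i
      have := le_totalDegree (support_topComponent_subset _ h hd')
      have := rowDeg_le_degree d' i
      omega
    have heq : rowDeg d = rowDeg d₀ :=
      eq_of_sum_mul_pow_eq (rowDeg d) (rowDeg d₀) (hlt d hd) (hlt d₀ hd₀s)
        (by rw [← weight_rowWeight, ← weight_rowWeight, hwd, hwd₀])
    rw [Finset.mem_filter]
    refine ⟨Finset.mem_univ _, ?_⟩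
    rw [← heq]
    exact rowDeg_pos_of_mem hv

/-- `ST_N` is row-lexicographically homogeneous (every monomial has row degrees all `1`).
[folklore] -/
theorem isWeightedHomogeneous_stPoly (B : ℕ) :
    IsWeightedHomogeneous (rowWeight B) (stPoly ℝ≥0 N) (∑ i : Fin N, B ^ (i : ℕ)) := by
  classical
  rw [stPoly_eq_sum_monomial]
  refine IsWeightedHomogeneous.sum _ _ _ fun t _ => ?_
  refine isWeightedHomogeneous_monomial _ _ _ ?_
  rw [arbMonomial, map_sum]
  refine Finset.sum_congr rfl fun i _ => ?_
  simp [Finsupp.weight_apply, rowWeight]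

end Rows

/-! ### The theorem: a cofactor of degree `δ` buys at most `δ` rows of `ST` -/

section Main

variable {N : ℕ}

/-- **Low-degree cofactors do not help the spanning-tree polynomial.**  For every nonzero
`h ∈ ℝ≥0[x]` with `deg h + 60 ≤ N`:  `2^{(N - deg h)/20} ≤ L_{ℝ≥0}(ST_N · h) + 1`.
Proof: pass to the top row-lexicographic component (free, `complexity_topComponent_le`;
`ST_N` is row-homogeneous so `top(ST·h) = ST · top h`), which concentrates the cofactor on a set
`R` of at most `deg h` rows; the projection `killRows` (rows of `R ↦ 1`, pointers into `R ↦ 0`,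
rename) turns `top h` into a nonzero constant and `ST_N` into a polynomial with the support of
`ST_{N-|R|}`, to which Jerrum–Snir's (support-only) bound applies. [folklore] -/
theorem two_rpow_le_complexity_stPoly_mul {h : MvPolynomial (Fin N × Option (Fin N)) ℝ≥0}
    (hh : h ≠ 0) (hN : h.totalDegree + 60 ≤ N) :
    (2 : ℝ) ^ ((1 / 20 : ℝ) * (N - h.totalDegree : ℕ)) ≤
      complexity (stPoly ℝ≥0 N * h) + 1 := by
  classical
  set δ := h.totalDegree with hδ
  set W := rowWeight (N := N) (β := Option (Fin N)) (δ + 1) with hW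
  obtain ⟨R, hRcard, hrows⟩ := exists_rows_topComponent hh
  set hs := topComponent W h with hhs
  have hne : hs ≠ 0 := topComponent_ne_zero _ hh
  -- the complement of `R` and its size
  set M := Fintype.card {i : Fin N // i ∉ R} with hM
  have hMeq : M = N - R.card := by
    rw [hM, Fintype.card_subtype_compl, Fintype.card_fin, Fintype.card_coe]
  have hM60 : 60 ≤ M := by omega
  let e : {i : Fin N // i ∉ R} ≃ Fin M := Fintype.equivFin _
  -- (1) initial form: `L(ST · hs) ≤ L(ST · h)`
  have h1 : complexity (stPoly ℝ≥0 N * hs) ≤ complexity (stPoly ℝ≥0 N * h) := by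
    have := complexity_topComponent_le W (stPoly ℝ≥0 N * h)
    rwa [topComponent_mul, topComponent_eq_self_of_isWeightedHomogeneous W
      (isWeightedHomogeneous_stPoly (δ + 1))] at this
  -- (2) projection: `L(aeval φ (ST · hs)) ≤ L(ST · hs)` and `aeval φ (ST · hs) = q * C η`
  set q := aeval (killRows R e) (stPoly ℝ≥0 N) with hq
  set η : ℝ≥0 := ∑ d ∈ hs.support, coeff d hs with hη
  have hη0 : η ≠ 0 := sum_coeff_ne_zero hne
  have h2 : complexity (q * C η) ≤ complexity (stPoly ℝ≥0 N * hs) := by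
    have := complexity_le_of_isProjection (isProjection_killRows R e (stPoly ℝ≥0 N * hs))
    rwa [map_mul, aeval_killRows_eq_C R e hrows] at this
  -- (3) unscale: `L(q) ≤ L(q * C η) + 1`
  have h3 : complexity q ≤ complexity (q * C η) + 1 := by
    have hqq : q = η⁻¹ • (q * C η) := by
      rw [mul_comm, smul_eq_C_mul, ← mul_assoc, ← C_mul, inv_mul_cancel₀ hη0, C_1, one_mul]
    conv_lhs => rw [hqq]
    exact complexity_smul_le_holds _ _
  -- (4) Jerrum–Snir by support on `Fin M`
  have h4 : (2 : ℝ) ^ ((1 / 20 : ℝ) * M) ≤ complexity q :=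
    two_rpow_le_complexity_of_support_eq hM60 (support_aeval_killRows_stPoly R e)
  -- combine
  have hmono : (2 : ℝ) ^ ((1 / 20 : ℝ) * (N - δ : ℕ)) ≤ (2 : ℝ) ^ ((1 / 20 : ℝ) * M) := by
    apply Real.rpow_le_rpow_of_exponent_le (by norm_num)
    have : ((N - δ : ℕ) : ℝ) ≤ M := by exact_mod_cast (show N - δ ≤ M by omega)
    linarith
  calc (2 : ℝ) ^ ((1 / 20 : ℝ) * (N - δ : ℕ)) ≤ complexity q := hmono.trans h4
    _ ≤ (complexity (q * C η) : ℝ) + 1 := by exact_mod_cast h3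
    _ ≤ (complexity (stPoly ℝ≥0 N * h) : ℝ) + 1 := by
        have h21 : (complexity (q * C η) : ℝ) ≤ complexity (stPoly ℝ≥0 N * h) := by
          exact_mod_cast h2.trans h1
        linarith

/-- Growth: for every `c` there is `N ≥ 120` with `40 ((log₂ N + c)^c + 1) < N`. [folklore] -/
theorem exists_qp_lt_forty (c : ℕ) : ∃ N : ℕ, 120 ≤ N ∧ 40 * ((Nat.log 2 N + c) ^ c + 1) < N := by
  have ht := tendsto_pow_const_div_const_pow_of_one_lt (c + 1) (one_lt_two (α := ℝ))
  have hev : ∀ᶠ m : ℕ in Filter.atTop, (m : ℝ) ^ (c + 1) / 2 ^ m ≤ 1 :=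
    ht.eventually (ge_mem_nhds one_pos)
  obtain ⟨N₀, hN₀⟩ := Filter.eventually_atTop.1 hev
  set L : ℕ := max (max N₀ (80 * 2 ^ c + 1)) (max c 7) with hLdef
  have hL0 : N₀ ≤ L := le_trans (le_max_left _ _) (le_max_left _ _)
  have hL1 : 80 * 2 ^ c + 1 ≤ L := le_trans (le_max_right _ _) (le_max_left _ _)
  have hLc : c ≤ L := le_trans (le_max_left _ _) (le_max_right _ _)
  have hL7 : 7 ≤ L := le_trans (le_max_right _ _) (le_max_right _ _)
  refine ⟨2 ^ L, ?_, ?_⟩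
  · calc 120 ≤ 2 ^ 7 := by norm_num
      _ ≤ 2 ^ L := Nat.pow_le_pow_right two_pos hL7
  rw [Nat.log_pow one_lt_two]
  have h1 : (L : ℝ) ^ (c + 1) / 2 ^ L ≤ 1 := hN₀ L hL0
  rw [div_le_one (by positivity)] at h1
  have h2 : L ^ (c + 1) ≤ 2 ^ L := by exact_mod_cast h1
  have hpos : 1 ≤ L ^ c := Nat.one_le_pow _ _ (by omega)
  have hpow2 : 1 ≤ 2 ^ c := Nat.one_le_two_pow
  calc 40 * ((L + c) ^ c + 1) ≤ 40 * ((2 * L) ^ c + L ^ c) := by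
        apply Nat.mul_le_mul_left
        exact add_le_add (Nat.pow_le_pow_left (by omega) c) hpos
    _ = (40 * 2 ^ c + 40) * L ^ c := by rw [mul_pow]; ring
    _ < (80 * 2 ^ c + 1) * L ^ c := Nat.mul_lt_mul_of_pos_right (by omega) (by omega)
    _ ≤ L * L ^ c := Nat.mul_le_mul_right _ hL1
    _ = L ^ (c + 1) := by ring
    _ ≤ 2 ^ L := h2

open Summit.ValiantsHypothesis.ValiantsHypothesis.Theses.DivisionGap (ZeroOneTransfer)

/-- **`ZeroOneTransfer` with LOW-DEGREE cofactors is false.**  The natural strengthening of the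
crux asking in addition that the cofactor have degree at most half the degree of `f_n` fails:
for `f = ST` (0/1 coefficients, `VP_ℂ`) a cofactor of degree `≤ deg(ST_N)/2 ≤ N/2` still leaves
`L(ST_N · h) + 1 ≥ 2^{N/40}` by `two_rpow_le_complexity_stPoly_mul`.  So every positivity
normal form `f·h = g` behind a proof of the crux must use cofactors of degree comparable to
`deg f` (for `ST`: `> N - O((log N)^c)`). [folklore] -/
theorem zeroOneTransfer_lowDegreeCofactor_false :
    ¬ (∀ (σ : ℕ → Type) [∀ n, Fintype (σ n)] (f : ∀ n, MvPolynomial (σ n) ℝ≥0),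
        (∀ n m, MvPolynomial.coeff m (f n) = 0 ∨ MvPolynomial.coeff m (f n) = 1) →
        Literature.Computability.AlgebraicComplexity.IsVPFamily (k := ℂ)
          (fun n => MvPolynomial.map (Complex.ofRealHom.comp NNReal.toRealHom) (f n)) →
        ∃ c : ℕ, ∀ n, ∃ h : MvPolynomial (σ n) ℝ≥0, h ≠ 0 ∧
          h.totalDegree ≤ (f n).totalDegree / 2 ∧
          Literature.Computability.AlgebraicComplexity.complexity (f n * h) +
            Literature.Computability.AlgebraicComplexity.complexity h ≤
              2 ^ ((Nat.log 2 n + c) ^ c)) := by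
  intro H
  have hmap : (fun N => map (Complex.ofRealHom.comp NNReal.toRealHom) (stPoly ℝ≥0 N)) =
      fun N => stPoly ℂ N := by
    funext N; exact map_stPoly _ N
  have hVP : IsVPFamily (k := ℂ)
      (fun N => map (Complex.ofRealHom.comp NNReal.toRealHom) (stPoly ℝ≥0 N)) := by
    rw [hmap]; exact isVPFamily_stPoly_holds ℂ
  have h01 : ∀ (N : ℕ) (m : (Fin N × Option (Fin N)) →₀ ℕ),
      coeff m (stPoly ℝ≥0 N) = 0 ∨ coeff m (stPoly ℝ≥0 N) = 1 := by
    intro N m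
    rw [coeff_stPoly]
    split_ifs <;> simp
  obtain ⟨c, hc⟩ := H (fun N => Fin N × Option (Fin N)) (fun N => stPoly ℝ≥0 N) h01 hVP
  obtain ⟨N, hN, hle⟩ := exists_qp_lt_forty c
  obtain ⟨h, hne, hdeg, hbound⟩ := hc N
  have hdegN : h.totalDegree ≤ N / 2 :=
    hdeg.trans (Nat.div_le_div_right (totalDegree_stPoly_le ℝ≥0 N))
  have hlow := two_rpow_le_complexity_stPoly_mul hne (by omega)
  generalize hE : (Nat.log 2 N + c) ^ c = E at hle hbound
  -- `L(ST·h) ≤ 2^E`, so `2^{(N - deg h)/20} ≤ 2^E + 1 ≤ 2^(E+1)`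
  have hup : (complexity (stPoly ℝ≥0 N * h) : ℝ) + 1 ≤ (2 : ℝ) ^ ((E + 1 : ℕ) : ℝ) := by
    rw [Real.rpow_natCast]
    have : complexity (stPoly ℝ≥0 N * h) + 1 ≤ 2 ^ (E + 1) := by
      have := (Nat.le_add_right _ _).trans hbound
      have h1E : 1 ≤ 2 ^ E := Nat.one_le_two_pow
      rw [pow_succ]; omega
    exact_mod_cast this
  have h1 : (1 / 20 : ℝ) * (N - h.totalDegree : ℕ) ≤ ((E + 1 : ℕ) : ℝ) :=
    (Real.rpow_le_rpow_left_iff one_lt_two).mp (hlow.trans hup)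
  have h2 : ((N - h.totalDegree : ℕ) : ℝ) ≤ 20 * ((E + 1 : ℕ) : ℝ) := by linarith
  have h3 : N - h.totalDegree ≤ 20 * (E + 1) := by exact_mod_cast h2
  omega

end Main

end

end Summit.ValiantsHypothesis.ValiantsHypothesis.Theorems.ZeroOneTransfer.Negative
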